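import Summits.QuantumFields.BalabanUV.Beta.FP.CompositeWardLetters
import Mathlib.Data.Matrix.Basic

/-!
# `BalabanUV.Beta.FP.CompositeWardLettersK` — road «FP» for binder row D1, ROUTE T branch (β): **THE COMPOSITE FORM's WARD LETTERS `a0 a1 a2`, ORDER BY ORDER,
# FROM THE FINE-FORM LETTERS, THE BLOCK LETTERS AND THE ONE-STEP COVARIANCE LETTERS** (the `𝔎`-half asked by the OWNER d1-p3 g17, W-FP-17-2 (1), journal
# l.37256, Z-SHAPE as stated there): for `𝔎 = H + Q₁ᵀGQ₁` (jets `𝔎ᵢ` NAMED as in `NestedStepLawOneShotJets`, p308750), FINE letters `HW = Q₁ᵀZ` (jets `Z₀ Z₁ Z₂ :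
# Matrix μ (ρ₂ ⊕ ρ₁) ℝ`, the gauge variation of the fine multiplier), BLOCK letters `Z + G·[D̄|0] = Q₂ᵀY` («fine multiplier variation + block form on the coarse
# generators is coarse-exact») and the one-step covariance `Q₁W = [D̄|0]`, each to second order, give `𝔎W = 𝔔ᵀY` to second order — the hypotheses `a0 a1 a2` of
# `secondVar_oneShot_nestedStepLaw_jets`; the transposed triple `a0t a1t a2t` for SYMMETRIC form jets (`Hᵢᵀ = Hᵢ`, `Gᵢᵀ = Gᵢ` ⇒ `𝔎ᵢᵀ = 𝔎ᵢ`, `Y' := Y`)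

HONEST DEPENDENCY (page 1, mandatory): continuum YM on T⁴ ⇐ BetaPertH ∧ nine spine estimates (0/9 proved); BetaPertH ⇐ (D1) ∧ (D4) ∧ CAP+tail;
G-an2-4 gates asym, D1 and NE2/3/4.  HONEST FRAMING (cell contract, verbatim): «discharging `BetaPertH` makes Bałaban's UV stability UNCONDITIONAL —
a real constructive-QFT result; it is NOT the continuum limit and NOT the Clay problem.»  ABSOLUTE RULE (cell charter, verbatim): «No internally-minted
statement may enter as a cited fact. Every hypothesis is either kernel-proved in this package or a verbatim quotation of a PUBLISHED theorem with page
reference. The manuscript(s) under audit are NOT citable for their own disputed steps — they are the thing under adjudication; programme-internal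
(2001/route/tribunal) claims are never citable.»  THIS MODULE is [folklore] finite-matrix Leibniz algebra (Mathlib + `CompositeWardLetters` plumbing); no `def`,
no `def … : Prop`, nothing cited, 0 sorry; 0∕4 row-D1 binders; the letters `f* g* c*` (TABLE IDENTITIES of the literal) are NOT proved here — NOT (T-ID), NOT SDF, NOT D1,
NOT BetaPertH, NOT continuum, NOT Clay.  «not in print; our bookkeeping».
ALGEBRA (owner's sentence): `𝔎W = HW + Q₁ᵀG(Q₁W) = Q₁ᵀ(Z + G[D̄|0]) = Q₁ᵀQ₂ᵀY = 𝔔ᵀY`, order by order with the binomial `2`s.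
Provenance: D1 formalisation swarm LEAF PROVER 02, unit b2b-balaban-beta-d1-formalise-leaf-02 gen 16, 2026-08-21.  No existing file touched. -/

namespace Summit.QuantumFields.BalabanUV.Beta.FP.CompositeWardLettersK

open Matrix
open Summit.QuantumFields.BalabanUV.Beta.FP.CompositeWardLetters (fromCols_add smul_fromCols)

variable {ν μ κ ρ₁ ρ₂ : Type*} [Fintype ν] [Fintype μ] [Fintype κ]

section Letters

variable (H₀ H₁ H₂ : Matrix ν ν ℝ) (Q₁₀ Q₁₁ Q₁₂ : Matrix μ ν ℝ) (Q₂₀ Q₂₁ Q₂₂ : Matrix κ μ ℝ) (G₀ G₁ G₂ : Matrix μ μ ℝ)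
  (W₀ W₁ W₂ : Matrix ν (ρ₂ ⊕ ρ₁) ℝ) (Db₀ Db₁ Db₂ : Matrix μ ρ₂ ℝ) (Z₀ Z₁ Z₂ : Matrix μ (ρ₂ ⊕ ρ₁) ℝ) (Y₀ Y₁ Y₂ : Matrix κ (ρ₂ ⊕ ρ₁) ℝ)
  {𝔎₀ 𝔎₁ 𝔎₂ : Matrix ν ν ℝ} {𝔔₀ 𝔔₁ 𝔔₂ : Matrix κ ν ℝ}

/-- [folklore] **ZEROTH ORDER**: `H₀W₀ = Q₁₀ᵀZ₀`, `Z₀ + G₀[D̄₀|0] = Q₂₀ᵀY₀`, `Q₁₀W₀ = [D̄₀|0]` ⇒ `𝔎₀W₀ = 𝔔₀ᵀY₀`. -/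
theorem compWard_a0 (f0 : H₀ * W₀ = Q₁₀ᵀ * Z₀) (g0 : Z₀ + G₀ * fromCols Db₀ 0 = Q₂₀ᵀ * Y₀) (c0 : Q₁₀ * W₀ = fromCols Db₀ 0)
    (h𝔎₀ : H₀ + Q₁₀ᵀ * G₀ * Q₁₀ = 𝔎₀) (h𝔔₀ : Q₂₀ * Q₁₀ = 𝔔₀) : 𝔎₀ * W₀ = 𝔔₀ᵀ * Y₀ := by
  have I : 𝔎₀ * W₀ = H₀ * W₀ + Q₁₀ᵀ * (G₀ * (Q₁₀ * W₀)) := by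
    rw [← h𝔎₀]; simp only [Matrix.add_mul, Matrix.mul_assoc]
  rw [I, f0, c0, ← Matrix.mul_add, g0, ← h𝔔₀, Matrix.transpose_mul, Matrix.mul_assoc]

/-- [folklore] **FIRST ORDER**: `f1 : H₁W₀ + H₀W₁ = Q₁₁ᵀZ₀ + Q₁₀ᵀZ₁`, `g1 : Z₁ + (G₁[D̄₀|0] + G₀[D̄₁|0]) = Q₂₁ᵀY₀ + Q₂₀ᵀY₁`, `c0`, `c1` (+ `g0`) ⇒
`𝔎₁W₀ + 𝔎₀W₁ = 𝔔₁ᵀY₀ + 𝔔₀ᵀY₁`. -/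
theorem compWard_a1 (f1 : H₁ * W₀ + H₀ * W₁ = Q₁₁ᵀ * Z₀ + Q₁₀ᵀ * Z₁)
    (g0 : Z₀ + G₀ * fromCols Db₀ 0 = Q₂₀ᵀ * Y₀) (g1 : Z₁ + (G₁ * fromCols Db₀ 0 + G₀ * fromCols Db₁ 0) = Q₂₁ᵀ * Y₀ + Q₂₀ᵀ * Y₁)
    (c0 : Q₁₀ * W₀ = fromCols Db₀ 0) (c1 : Q₁₁ * W₀ + Q₁₀ * W₁ = fromCols Db₁ 0)
    (h𝔎₀ : H₀ + Q₁₀ᵀ * G₀ * Q₁₀ = 𝔎₀) (h𝔎₁ : H₁ + (Q₁₁ᵀ * G₀ * Q₁₀ + Q₁₀ᵀ * G₁ * Q₁₀ + Q₁₀ᵀ * G₀ * Q₁₁) = 𝔎₁)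
    (h𝔔₀ : Q₂₀ * Q₁₀ = 𝔔₀) (h𝔔₁ : Q₂₁ * Q₁₀ + Q₂₀ * Q₁₁ = 𝔔₁) :
    𝔎₁ * W₀ + 𝔎₀ * W₁ = 𝔔₁ᵀ * Y₀ + 𝔔₀ᵀ * Y₁ := by
  have I : 𝔎₁ * W₀ + 𝔎₀ * W₁ = (H₁ * W₀ + H₀ * W₁)
      + (Q₁₁ᵀ * (G₀ * (Q₁₀ * W₀)) + Q₁₀ᵀ * (G₁ * (Q₁₀ * W₀)) + Q₁₀ᵀ * (G₀ * (Q₁₁ * W₀ + Q₁₀ * W₁))) := by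
    rw [← h𝔎₀, ← h𝔎₁]; simp only [Matrix.add_mul, Matrix.mul_add, Matrix.mul_assoc]; abel
  have II : Q₁₁ᵀ * Z₀ + Q₁₀ᵀ * Z₁ + (Q₁₁ᵀ * (G₀ * fromCols Db₀ 0) + Q₁₀ᵀ * (G₁ * fromCols Db₀ 0) + Q₁₀ᵀ * (G₀ * fromCols Db₁ 0))
      = Q₁₁ᵀ * (Z₀ + G₀ * fromCols Db₀ 0) + Q₁₀ᵀ * (Z₁ + (G₁ * fromCols Db₀ 0 + G₀ * fromCols Db₁ 0)) := by
    simp only [Matrix.mul_add]; abel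
  rw [I, f1, c0, c1, II, g0, g1, ← h𝔔₀, ← h𝔔₁]
  simp only [Matrix.transpose_add, Matrix.transpose_mul, Matrix.add_mul, Matrix.mul_add, Matrix.mul_assoc]
  abel

/-- [folklore] **SECOND ORDER**: `f2 : H₂W₀ + 2•(H₁W₁) + H₀W₂ = Q₁₂ᵀZ₀ + 2•(Q₁₁ᵀZ₁) + Q₁₀ᵀZ₂`,
`g2 : Z₂ + (G₂[D̄₀|0] + 2•(G₁[D̄₁|0]) + G₀[D̄₂|0]) = Q₂₂ᵀY₀ + 2•(Q₂₁ᵀY₁) + Q₂₀ᵀY₂`, `c0 c1 c2` (+ `g0 g1`) ⇒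
`𝔎₂W₀ + 2•(𝔎₁W₁) + 𝔎₀W₂ = 𝔔₂ᵀY₀ + 2•(𝔔₁ᵀY₁) + 𝔔₀ᵀY₂` for `𝔎₂`, `𝔔₂` NAMED as in p308750. -/
theorem compWard_a2 (f2 : H₂ * W₀ + (2 : ℝ) • (H₁ * W₁) + H₀ * W₂ = Q₁₂ᵀ * Z₀ + (2 : ℝ) • (Q₁₁ᵀ * Z₁) + Q₁₀ᵀ * Z₂)
    (g0 : Z₀ + G₀ * fromCols Db₀ 0 = Q₂₀ᵀ * Y₀) (g1 : Z₁ + (G₁ * fromCols Db₀ 0 + G₀ * fromCols Db₁ 0) = Q₂₁ᵀ * Y₀ + Q₂₀ᵀ * Y₁)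
    (g2 : Z₂ + (G₂ * fromCols Db₀ 0 + (2 : ℝ) • (G₁ * fromCols Db₁ 0) + G₀ * fromCols Db₂ 0) = Q₂₂ᵀ * Y₀ + (2 : ℝ) • (Q₂₁ᵀ * Y₁) + Q₂₀ᵀ * Y₂)
    (c0 : Q₁₀ * W₀ = fromCols Db₀ 0) (c1 : Q₁₁ * W₀ + Q₁₀ * W₁ = fromCols Db₁ 0)
    (c2 : Q₁₂ * W₀ + (2 : ℝ) • (Q₁₁ * W₁) + Q₁₀ * W₂ = fromCols Db₂ 0)
    (h𝔎₀ : H₀ + Q₁₀ᵀ * G₀ * Q₁₀ = 𝔎₀) (h𝔎₁ : H₁ + (Q₁₁ᵀ * G₀ * Q₁₀ + Q₁₀ᵀ * G₁ * Q₁₀ + Q₁₀ᵀ * G₀ * Q₁₁) = 𝔎₁)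
    (h𝔎₂ : H₂ + ((Q₁₂ᵀ * G₀ * Q₁₀ + Q₁₁ᵀ * G₁ * Q₁₀ + Q₁₁ᵀ * G₀ * Q₁₁) + (Q₁₁ᵀ * G₁ * Q₁₀ + Q₁₀ᵀ * G₂ * Q₁₀ + Q₁₀ᵀ * G₁ * Q₁₁)
            + (Q₁₁ᵀ * G₀ * Q₁₁ + Q₁₀ᵀ * G₁ * Q₁₁ + Q₁₀ᵀ * G₀ * Q₁₂)) = 𝔎₂)
    (h𝔔₀ : Q₂₀ * Q₁₀ = 𝔔₀) (h𝔔₁ : Q₂₁ * Q₁₀ + Q₂₀ * Q₁₁ = 𝔔₁) (h𝔔₂ : Q₂₂ * Q₁₀ + Q₂₁ * Q₁₁ + (Q₂₁ * Q₁₁ + Q₂₀ * Q₁₂) = 𝔔₂) :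
    𝔎₂ * W₀ + (2 : ℝ) • (𝔎₁ * W₁) + 𝔎₀ * W₂ = 𝔔₂ᵀ * Y₀ + (2 : ℝ) • (𝔔₁ᵀ * Y₁) + 𝔔₀ᵀ * Y₂ := by
  have I : 𝔎₂ * W₀ + (2 : ℝ) • (𝔎₁ * W₁) + 𝔎₀ * W₂ = (H₂ * W₀ + (2 : ℝ) • (H₁ * W₁) + H₀ * W₂)
      + (Q₁₂ᵀ * (G₀ * (Q₁₀ * W₀)) + (2 : ℝ) • (Q₁₁ᵀ * (G₁ * (Q₁₀ * W₀))) + (2 : ℝ) • (Q₁₁ᵀ * (G₀ * (Q₁₁ * W₀ + Q₁₀ * W₁)))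
        + Q₁₀ᵀ * (G₂ * (Q₁₀ * W₀)) + (2 : ℝ) • (Q₁₀ᵀ * (G₁ * (Q₁₁ * W₀ + Q₁₀ * W₁))) + Q₁₀ᵀ * (G₀ * (Q₁₂ * W₀ + (2 : ℝ) • (Q₁₁ * W₁) + Q₁₀ * W₂))) := by
    rw [← h𝔎₀, ← h𝔎₁, ← h𝔎₂]
    simp only [Matrix.add_mul, Matrix.mul_add, Matrix.mul_assoc, smul_add, two_smul]
    abel
  have II : Q₁₂ᵀ * Z₀ + (2 : ℝ) • (Q₁₁ᵀ * Z₁) + Q₁₀ᵀ * Z₂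
      + (Q₁₂ᵀ * (G₀ * fromCols Db₀ 0) + (2 : ℝ) • (Q₁₁ᵀ * (G₁ * fromCols Db₀ 0)) + (2 : ℝ) • (Q₁₁ᵀ * (G₀ * fromCols Db₁ 0))
        + Q₁₀ᵀ * (G₂ * fromCols Db₀ 0) + (2 : ℝ) • (Q₁₀ᵀ * (G₁ * fromCols Db₁ 0)) + Q₁₀ᵀ * (G₀ * fromCols Db₂ 0))
      = Q₁₂ᵀ * (Z₀ + G₀ * fromCols Db₀ 0) + (2 : ℝ) • (Q₁₁ᵀ * (Z₁ + (G₁ * fromCols Db₀ 0 + G₀ * fromCols Db₁ 0)))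
        + Q₁₀ᵀ * (Z₂ + (G₂ * fromCols Db₀ 0 + (2 : ℝ) • (G₁ * fromCols Db₁ 0) + G₀ * fromCols Db₂ 0)) := by
    simp only [Matrix.mul_add, smul_add, two_smul]; abel
  rw [I, f2, c0, c1, c2, II, g0, g1, g2, ← h𝔔₀, ← h𝔔₁, ← h𝔔₂]
  simp only [Matrix.transpose_add, Matrix.transpose_mul, Matrix.add_mul, Matrix.mul_add, Matrix.mul_assoc, smul_add, two_smul]
  abel

end Letters

/-! ## §2 The transposed triple for symmetric form jets -/

section Symm

variable (H₀ H₁ H₂ : Matrix ν ν ℝ) (Q₁₀ Q₁₁ Q₁₂ : Matrix μ ν ℝ) (G₀ G₁ G₂ : Matrix μ μ ℝ) {𝔎₀ 𝔎₁ 𝔎₂ : Matrix ν ν ℝ}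

omit [Fintype ν] [Fintype κ] in
/-- [folklore] `𝔎₀ᵀ = 𝔎₀` for symmetric `H₀`, `G₀`. -/
theorem 𝔎₀_transpose (hH : H₀ᵀ = H₀) (hG : G₀ᵀ = G₀) (h𝔎₀ : H₀ + Q₁₀ᵀ * G₀ * Q₁₀ = 𝔎₀) : 𝔎₀ᵀ = 𝔎₀ := by
  rw [← h𝔎₀, Matrix.transpose_add, hH, Matrix.transpose_mul, Matrix.transpose_mul, Matrix.transpose_transpose, hG, Matrix.mul_assoc]

omit [Fintype ν] [Fintype κ] in
/-- [folklore] `𝔎₁ᵀ = 𝔎₁` for symmetric `H₁`, `G₀`, `G₁`. -/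
theorem 𝔎₁_transpose (hH : H₁ᵀ = H₁) (hG0 : G₀ᵀ = G₀) (hG1 : G₁ᵀ = G₁)
    (h𝔎₁ : H₁ + (Q₁₁ᵀ * G₀ * Q₁₀ + Q₁₀ᵀ * G₁ * Q₁₀ + Q₁₀ᵀ * G₀ * Q₁₁) = 𝔎₁) : 𝔎₁ᵀ = 𝔎₁ := by
  rw [← h𝔎₁]
  simp only [Matrix.transpose_add, Matrix.transpose_mul, Matrix.transpose_transpose, hH, hG0, hG1, Matrix.mul_assoc]
  abel

omit [Fintype ν] [Fintype κ] in
/-- [folklore] `𝔎₂ᵀ = 𝔎₂` for symmetric `H₂`, `G₀`, `G₁`, `G₂`. -/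
theorem 𝔎₂_transpose (hH : H₂ᵀ = H₂) (hG0 : G₀ᵀ = G₀) (hG1 : G₁ᵀ = G₁) (hG2 : G₂ᵀ = G₂)
    (h𝔎₂ : H₂ + ((Q₁₂ᵀ * G₀ * Q₁₀ + Q₁₁ᵀ * G₁ * Q₁₀ + Q₁₁ᵀ * G₀ * Q₁₁) + (Q₁₁ᵀ * G₁ * Q₁₀ + Q₁₀ᵀ * G₂ * Q₁₀ + Q₁₀ᵀ * G₁ * Q₁₁)
            + (Q₁₁ᵀ * G₀ * Q₁₁ + Q₁₀ᵀ * G₁ * Q₁₁ + Q₁₀ᵀ * G₀ * Q₁₂)) = 𝔎₂) : 𝔎₂ᵀ = 𝔎₂ := by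
  rw [← h𝔎₂]
  simp only [Matrix.transpose_add, Matrix.transpose_mul, Matrix.transpose_transpose, hH, hG0, hG1, hG2, Matrix.mul_assoc]
  abel

variable (W₀ W₁ W₂ : Matrix ν (ρ₂ ⊕ ρ₁) ℝ) (Y₀ Y₁ Y₂ : Matrix κ (ρ₂ ⊕ ρ₁) ℝ) {𝔔₀ 𝔔₁ 𝔔₂ : Matrix κ ν ℝ}

/-- [folklore] **THE TRANSPOSED TRIPLE FOR SYMMETRIC FORM JETS**: `a0 a1 a2` with `𝔎ᵢᵀ = 𝔎ᵢ` are `a0t a1t a2t` with `Y' := Y`. -/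
theorem compWard_at_of_symm (s0 : 𝔎₀ᵀ = 𝔎₀) (s1 : 𝔎₁ᵀ = 𝔎₁) (s2 : 𝔎₂ᵀ = 𝔎₂)
    (a0 : 𝔎₀ * W₀ = 𝔔₀ᵀ * Y₀) (a1 : 𝔎₁ * W₀ + 𝔎₀ * W₁ = 𝔔₁ᵀ * Y₀ + 𝔔₀ᵀ * Y₁)
    (a2 : 𝔎₂ * W₀ + (2 : ℝ) • (𝔎₁ * W₁) + 𝔎₀ * W₂ = 𝔔₂ᵀ * Y₀ + (2 : ℝ) • (𝔔₁ᵀ * Y₁) + 𝔔₀ᵀ * Y₂) :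
    𝔎₀ᵀ * W₀ = 𝔔₀ᵀ * Y₀ ∧ 𝔎₁ᵀ * W₀ + 𝔎₀ᵀ * W₁ = 𝔔₁ᵀ * Y₀ + 𝔔₀ᵀ * Y₁
      ∧ 𝔎₂ᵀ * W₀ + (2 : ℝ) • (𝔎₁ᵀ * W₁) + 𝔎₀ᵀ * W₂ = 𝔔₂ᵀ * Y₀ + (2 : ℝ) • (𝔔₁ᵀ * Y₁) + 𝔔₀ᵀ * Y₂ := by
  rw [s0, s1, s2]; exact ⟨a0, a1, a2⟩

end Symm

end Summit.QuantumFields.BalabanUV.Beta.FP.CompositeWardLettersK
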